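import Mathlib
import Summits.ValiantsHypothesis.ValiantsHypothesis.Theorems.BarrierLeverDefinableEquationsExplicitCoefficientsGeneric
import Summits.ValiantsHypothesis.ValiantsHypothesis.Theorems.BarrierLeverDefinableEquationsLevelOneStatus

/-!
# Crux `BarrierLever.DefinableEquations` (stmt-8745) / `SingleSizeEquations` (stmt-8749) — THE
# LEVER ON EXPLICIT COEFFICIENT FUNCTIONS (weakest form the route consumes; val-np-p5 g7)

The route's open load after level reduction is
`SuccinctHittingSetsForVP → (∀ b ∃ a, Eq(n, b, a) infinitely often)`
(`LevelOneStatus.valiantsHypothesis_of_succinct_of_singleSize_io`).  With the explicit-coefficient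
normal form (`ExplicitCoefficients.boolSum_of_explicit` / `explicit_of_boolSum`, any property,
full coefficient variables) the SAME lever runs on:

* `valiantsHypothesis_of_succinct_of_explicit_io` — `SuccinctHittingSetsForVP` together with:
  for every `b` a scale `c` such that for INFINITELY MANY `n` some NONZERO
  `E ∈ ℂ[degLEMonomials n]` with `N^c`-explicit coefficient function (cube marginal of one
  bits-only `Q₀`, `D, r, L, deg ≤ N^c`) vanishes on `coeff(SmallCircuits ℂ n b)` — implies
  `ValiantsHypothesis`;
* `explicit_io_iff_singleSize_io` — the two infinitely-often forms are equivalent.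

So the weakest statement a future seat has to supply to close the route's 𝒟-side is: per size
exponent `b`, infinitely often in `n`, ONE explicit coefficient function.  Honest scope: conditional
on the rank-2 crux `SuccinctHittingSetsForVP` (open, FSV Question 6) exactly as the route's
assembly; nothing here bears on `VP ≠ VNP` unconditionally.  No definitions, no named facts.
Refs: Forbes–Shpilka–Volk 2018 (Question 6, Thm 4); Bürgisser 2000, Prop. 2.20.
-/

set_option linter.dupNamespace false

noncomputable section

namespace Summit.ValiantsHypothesis.ValiantsHypothesis.Theorems.BarrierLeverDefinableEquations

open MvPolynomial Literature.Computability.AlgebraicComplexity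
open Literature.Barriers.ValiantsHypothesis
open scoped BigOperators

open ExplicitCoefficients

/-- **The infinitely-often forms agree**: `∀ b ∃ a ∀ n₀ ∃ n ≥ n₀, Eq(n, b, a)` iff
`∀ b ∃ c ∀ n₀ ∃ n ≥ n₀`, an `N^c`-explicit nonzero equation of `coeff(SmallCircuits ℂ n b)`.
[cite: Burgisser2000, Prop. 2.20] -/
theorem explicit_io_iff_singleSize_io :
    (∀ b : ℕ, ∃ c : ℕ, ∀ n₀ : ℕ, ∃ n : ℕ, n₀ ≤ n ∧
      ∃ D r : ℕ, D ≤ (Nat.choose (2 * n) n) ^ c ∧ r ≤ (Nat.choose (2 * n) n) ^ c ∧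
      ∃ Q₀ : MvPolynomial ((↥(degLEMonomials n) × Fin (D + 1)) ⊕ Fin r) ℂ,
        complexity Q₀ ≤ (Nat.choose (2 * n) n) ^ c ∧
        Q₀.totalDegree ≤ (Nat.choose (2 * n) n) ^ c ∧
        ∃ E : MvPolynomial ↥(degLEMonomials n) ℂ, E ≠ 0 ∧
          (∀ f ∈ SmallCircuits ℂ n b, eval (coeffVector (degLEMonomials n) f) E = 0) ∧
          (∀ m ∈ E.support, ∀ e, m e ≤ D) ∧
          ∀ m : ↥(degLEMonomials n) →₀ ℕ, (∀ e, m e ≤ D) → coeff m E =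
            ∑ w : Fin r → Bool, eval (fun x => if Sum.elim
              (fun p : ↥(degLEMonomials n) × Fin (D + 1) => decide (m p.1 = (p.2 : ℕ))) w x
              then (1 : ℂ) else 0) Q₀) ↔
    (∀ b : ℕ, ∃ a : ℕ, ∀ n₀ : ℕ, ∃ n : ℕ, n₀ ≤ n ∧ ∃ q : ℕ, q ≤ (Nat.choose (2 * n) n) ^ a ∧
      ∃ H : MvPolynomial (↥(degLEMonomials n) ⊕ Fin q) ℂ,
        complexity H ≤ (Nat.choose (2 * n) n) ^ a ∧
        H.totalDegree ≤ (Nat.choose (2 * n) n) ^ a ∧ boolSum H ≠ 0 ∧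
        ∀ f ∈ SmallCircuits ℂ n b, eval (coeffVector (degLEMonomials n) f) (boolSum H) = 0) := by
  classical
  constructor
  · intro h b
    obtain ⟨c, hc⟩ := h b
    refine ⟨2 * c + 7, fun n₀ => ?_⟩
    obtain ⟨n, hn, hex⟩ := hc (max n₀ 2)
    haveI : Fintype ↥(degLEMonomials n) := (Finsupp.finite_of_degree_le (σ := Fin n) n).fintype
    obtain ⟨hN, hI⟩ := ExplicitCoefficients.budget (le_trans (le_max_right _ _) hn)
    exact ⟨n, le_trans (le_max_left _ _) hn, boolSum_of_explicit hN hI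
      (fun E => ∀ f ∈ SmallCircuits ℂ n b, eval (coeffVector (degLEMonomials n) f) E = 0) hex⟩
  · intro h b
    obtain ⟨a, ha⟩ := h b
    refine ⟨2 * a + 7, fun n₀ => ?_⟩
    obtain ⟨n, hn, hex⟩ := ha (max n₀ 2)
    haveI : Fintype ↥(degLEMonomials n) := (Finsupp.finite_of_degree_le (σ := Fin n) n).fintype
    obtain ⟨hN, hI⟩ := ExplicitCoefficients.budget (le_trans (le_max_right _ _) hn)
    exact ⟨n, le_trans (le_max_left _ _) hn, explicit_of_boolSum hN hI
      (fun E => ∀ f ∈ SmallCircuits ℂ n b, eval (coeffVector (degLEMonomials n) f) E = 0) hex⟩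

/-- **The lever on explicit coefficient functions.**  `SuccinctHittingSetsForVP` and — for every
size exponent `b`, at some scale `c`, for INFINITELY MANY `n` — a nonzero `N^c`-explicit equation
of `coeff(SmallCircuits ℂ n b)` together imply `ValiantsHypothesis`
(`LevelOneStatus.valiantsHypothesis_of_succinct_of_singleSize_io` after
`explicit_io_iff_singleSize_io`).
[cite: ForbesShpilkaVolk2018, Thm. 4] -/
theorem valiantsHypothesis_of_succinct_of_explicit_io
    (hSHS :
      Summit.ValiantsHypothesis.ValiantsHypothesis.Theses.BarrierLever.SuccinctHittingSetsForVP)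
    (hio : ∀ b : ℕ, ∃ c : ℕ, ∀ n₀ : ℕ, ∃ n : ℕ, n₀ ≤ n ∧
      ∃ D r : ℕ, D ≤ (Nat.choose (2 * n) n) ^ c ∧ r ≤ (Nat.choose (2 * n) n) ^ c ∧
      ∃ Q₀ : MvPolynomial ((↥(degLEMonomials n) × Fin (D + 1)) ⊕ Fin r) ℂ,
        complexity Q₀ ≤ (Nat.choose (2 * n) n) ^ c ∧
        Q₀.totalDegree ≤ (Nat.choose (2 * n) n) ^ c ∧
        ∃ E : MvPolynomial ↥(degLEMonomials n) ℂ, E ≠ 0 ∧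
          (∀ f ∈ SmallCircuits ℂ n b, eval (coeffVector (degLEMonomials n) f) E = 0) ∧
          (∀ m ∈ E.support, ∀ e, m e ≤ D) ∧
          ∀ m : ↥(degLEMonomials n) →₀ ℕ, (∀ e, m e ≤ D) → coeff m E =
            ∑ w : Fin r → Bool, eval (fun x => if Sum.elim
              (fun p : ↥(degLEMonomials n) × Fin (D + 1) => decide (m p.1 = (p.2 : ℕ))) w x
              then (1 : ℂ) else 0) Q₀) :
    _root_.ValiantsHypothesis :=
  LevelOneStatus.valiantsHypothesis_of_succinct_of_singleSize_io hSHS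
    (explicit_io_iff_singleSize_io.mp hio)

end Summit.ValiantsHypothesis.ValiantsHypothesis.Theorems.BarrierLeverDefinableEquations

end
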